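import Literature.AlgebraicGeometry.Frobenioids.PadicFrobenioidFieldUnitsColimit
import HarnessLib

/-!
# Frobenioids II, Thm. 2.4 (ii), first step (δ): the induced `K̄₁^× ⥲ K̄₂^×` is EQUIVARIANT
# for the automorphisms of the cofinal system ("compatible with `G₁ ⥲ G₂`", formal half)

Mochizuki, *The geometry of Frobenioids II*, Kyushu J. Math. **62** (2008) 401–460, §2, proof of Theorem
2.4 (ii), p. 20 l.−3 – p. 21 l.6 [cite: MochizukiFrdII2008, Thm 2.4 (ii) p.20], VERBATIM (author's PDF,
`paper:url-4322d76898e0` p. 20 last 3 lines – p. 21 l. 6): "Then since `Φᵢ` is fieldwise saturated, it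
follows — by varying the objects `Aᵢ` [that correspond via `Ψ`] and reconstructing the multiplicative group
associated to the field determined by the image of `Aᵢ` in `B(Gᵢ, Gᵢ°)` as the groupification of the monoid
`O^▷(Aᵢ) = O^□(Aᵢ)` — that `Ψ` induces a pair of compatible isomorphisms `G₁ ⥲ G₂`; `K̄₁^× ⥲ K̄₂^×` — where
this pair is well-defined up to composition with automorphisms of the pair `(G₂, K̄₂^×)` induced by elements
of `G₂`."

PROOF-ONLY file (abc-iut cell, layer L1, `plan/L1/SUBDAG-FrdII-Thm24.md` row **W12-L17 `PairIso`**, piece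
(δ) of seat abc-iut-w5-d188's census), over (β)/(γ) (`PadicFrobenioidFieldUnitsColimit.lean`).

WHAT IS PROVED ("compatible", formal half).  Fix a system of objects `c : J ⥤ Dᵒᵖ` (print: the objects `Aᵢ`
of a universal covering, "by varying `Aᵢ`").  The monoid `End c` of natural endomorphisms of `c` — in
particular the group `Aut c` of COMPATIBLE FAMILIES OF AUTOMORPHISMS `σ_j ∈ Aut_D(A_j)`, which for a cofinal
system of Galois objects of a connected Galois-type base is the pro-finite group `lim_j Gal(A_j)`, i.e. the
fundamental group `G` acting on the universal covering — acts on every direct limit `lim→_j F(A_j)`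
(`F : Dᵒᵖ ⥤ CommMonCat`) by functoriality of colimits, `σ ↦ colimMap (whiskerRight σ F)`; and the base
equivalence `E = Ψ^Base : D₁ ≌ D₂` sends `σ ∈ End c` to `whiskerRight σ E^op ∈ End (c ⋙ E^op)` (the
"`G₁ ⥲ G₂`" on compatible families).  We prove:
* `colimMap_whiskerLeft_whiskerRight_comm` — the exchange law: a natural transformation `τ : F ⟶ G`
  induces an `End c`-EQUIVARIANT map of direct limits (pure naturality);
* (δβ) `colimit_toB0_iso_equivariant` — the (β) isomorphism `lim→_j B(A_j) ≅ lim→_j K_{A_j}^×` of a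
  fieldwise saturated datum is `End c`-equivariant;
* (δγ) `colimit_transport_iso_equivariant` — the (γ) transport isomorphism
  `lim→_j B₁(A_j) ≅ lim→_j B₂(Ψ A_j)` built from the L02 slot `ΨB : B₁ ≅ E^op ⋙ B₂` intertwines `σ` and
  `Ψ^Base(σ)`;
* (δ) `exists_fieldUnits_colimit_iso_equivariant` — for FIELDWISE SATURATED `Φ₁`, `Φ₂` there is an
  isomorphism `lim→_j K_{1,A_j}^× ≅ lim→_j K_{2,Ψ A_j}^×` intertwining, for EVERY `σ ∈ End c`, the action of
  `σ` with that of `Ψ^Base(σ)` — the pair "(`G₁ ⥲ G₂`, `K̄₁^× ⥲ K̄₂^×`) of compatible isomorphisms" at the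
  level of compatible families of automorphisms of the chosen cofinal system.
WHAT IS NOT PROVED HERE (recorded as GAP-LEDGER row G-w5d188-1, base-structure class): the identification
`Aut c = G = π₁` of the connected quasi-temperoid base `D = B^temp(Π, Π°)⁰` along a cofinal Galois system,
and the statement that two cofinal Galois systems of `D₂` (`E ∘ c` versus a system chosen in `D₂`) have
direct limits isomorphic up to the `G₂`-action — the "well-defined up to … elements of `G₂`" clause.
Theorems only; no new definitions; nothing here bears on [IUTchIII] Cor. 3.12.
-/

namespace Literature.AlgebraicGeometry.Frobenioids

open CategoryTheory CategoryTheory.Limits Opposite Function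

universe w w' v v₂ v₃ u u₂ u₃

/-! ### The exchange law: natural transformations induce `End c`-equivariant maps of colimits -/

/-- **Exchange law for induced maps of colimits.**  For systems `c c' : J ⥤ K`, a morphism of systems
`α : c ⟶ c'`, functors `F G : K ⥤ C` and a natural transformation `τ : F ⟶ G`, the two ways round the square
`lim→ (c ⋙ F) → lim→ (c' ⋙ G)` agree: `colimMap (c ◁ τ) ≫ colimMap (α ▷ G) = colimMap (α ▷ F) ≫ colimMap (c' ◁ τ)`.
With `c = c'` and `α` an endomorphism this says: the map of direct limits induced by `τ` is EQUIVARIANT for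
the action of `End c` (pure naturality of `τ`). [cite: MochizukiFrdII2008, Thm 2.4 (ii) p.21] -/
theorem colimMap_whiskerLeft_whiskerRight_comm {J : Type w} [Category.{w'} J] {K : Type u₂}
    [Category.{v₂} K] {C : Type u₃} [Category.{v₃} C] {c c' : J ⥤ K} (α : c ⟶ c') {F G : K ⥤ C}
    (τ : F ⟶ G) [HasColimit (c ⋙ F)] [HasColimit (c ⋙ G)] [HasColimit (c' ⋙ F)]
    [HasColimit (c' ⋙ G)] :
    colimMap (Functor.whiskerLeft c τ) ≫ colimMap (Functor.whiskerRight α G) =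
      colimMap (Functor.whiskerRight α F) ≫ colimMap (Functor.whiskerLeft c' τ) := by
  refine colimit.hom_ext fun j => ?_
  simp only [ι_colimMap_assoc, Functor.whiskerLeft_app, ι_colimMap, Functor.whiskerRight_app]
  exact (τ.naturality_assoc (α.app j) _).symm

/-- The isomorphism of colimits induced by a natural ISOMORPHISM `w : F ≅ G` (whiskered along the system
`c`) is `End c`-equivariant: `(isoOfNatIso (c ◁ w)).hom ≫ colimMap (α ▷ G) = colimMap (α ▷ F) ≫ (isoOfNatIso (c' ◁ w)).hom`.
[cite: MochizukiFrdII2008, Thm 2.4 (ii) p.21] -/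
theorem isoOfNatIso_whiskerLeft_hom_whiskerRight_comm {J : Type w} [Category.{w'} J] {K : Type u₂}
    [Category.{v₂} K] {C : Type u₃} [Category.{v₃} C] {c c' : J ⥤ K} (α : c ⟶ c') {F G : K ⥤ C}
    (w : F ≅ G) [HasColimit (c ⋙ F)] [HasColimit (c ⋙ G)] [HasColimit (c' ⋙ F)]
    [HasColimit (c' ⋙ G)] :
    (HasColimit.isoOfNatIso (Functor.isoWhiskerLeft c w)).hom ≫
        colimMap (Functor.whiskerRight α G) =
      colimMap (Functor.whiskerRight α F) ≫
        (HasColimit.isoOfNatIso (Functor.isoWhiskerLeft c' w)).hom := by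
  refine colimit.hom_ext fun j => ?_
  simp only [HasColimit.isoOfNatIso_ι_hom_assoc, Functor.isoWhiskerLeft_hom,
    Functor.whiskerLeft_app, ι_colimMap, Functor.whiskerRight_app, ι_colimMap_assoc,
    HasColimit.isoOfNatIso_ι_hom]
  exact (w.hom.naturality_assoc (α.app j) _).symm

namespace PadicFrd.Datum

variable {D : Type u} [Category.{v} D] {p : ℕ} [Fact p.Prime] (d : Datum D p)

/-! ### (δβ) the (β) isomorphism `lim→ B(A_j) ≅ lim→ K_{A_j}^×` is equivariant -/

/-- **(δβ)** For a fieldwise saturated datum and ANY morphism of systems `α : c ⟶ c'` (in particular any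
`σ ∈ End c`, e.g. a compatible family of deck transformations), the (β) isomorphisms
`lim→_j B(A_j) ≅ lim→_j K_{A_j}^×` along `c` and `c'` (induced by `B ⥲ B₀|_D`) intertwine the maps of direct
limits induced by `α` on `B` and on `B₀|_D = (A ↦ K_A^×)`: the reconstruction "`K_{Aᵢ}^× = O^▷(Aᵢ)^gp`,
varying `Aᵢ`" is compatible with the action of compatible families of automorphisms.
[cite: MochizukiFrdII2008, Thm 2.4 (ii) p.21] -/
theorem colimit_toB0_iso_equivariant (hfs : d.IsFieldwiseSaturated) {J : Type w} [Category.{w'} J]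
    {c c' : J ⥤ Dᵒᵖ} (α : c ⟶ c') [HasColimit (c ⋙ d.B)] [HasColimit (c ⋙ bZeroOn d.base)]
    [HasColimit (c' ⋙ d.B)] [HasColimit (c' ⋙ bZeroOn d.base)] :
    haveI := d.isIso_toB0_of_isFieldwiseSaturated hfs
    (HasColimit.isoOfNatIso (Functor.isoWhiskerLeft c (asIso d.toB0))).hom ≫
        colimMap (Functor.whiskerRight α (bZeroOn d.base)) =
      colimMap (Functor.whiskerRight α d.B) ≫
        (HasColimit.isoOfNatIso (Functor.isoWhiskerLeft c' (asIso d.toB0))).hom :=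
  isoOfNatIso_whiskerLeft_hom_whiskerRight_comm α _

end PadicFrd.Datum

/-! ### (δγ) the transport isomorphism along `Ψ` intertwines `σ` and `Ψ^Base(σ)` -/

namespace PadicFrd

variable {D₁ : Type u} [Category.{v} D₁] {D₂ : Type u} [Category.{v₂} D₂] {p₁ p₂ : ℕ}
  [Fact p₁.Prime] [Fact p₂.Prime] (d₁ : Datum D₁ p₁) (d₂ : Datum D₂ p₂)

/-- **(δγ)** Given the base equivalence `E = Ψ^Base : D₁ ≌ D₂` and the natural isomorphism
`ΨB : B₁ ≅ E^op ⋙ B₂` (sub-DAG row L02, DISPLAYED AS HYPOTHESES), the (γ) transport isomorphism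
`lim→_j B₁(A_j) ≅ lim→_j B₂(Ψ A_j)` intertwines, for every morphism of systems `α : c ⟶ c'`, the map induced
by `α` on `B₁` with the map induced by its image `α ▷ E^op : c ⋙ E^op ⟶ c' ⋙ E^op` ("`G₁ ⥲ G₂`" on
compatible families) on `B₂`. [cite: MochizukiFrdII2008, Thm 2.4 (ii) p.21] -/
theorem colimit_transport_iso_equivariant (E : D₁ ≌ D₂) (ΨB : d₁.B ≅ E.functor.op ⋙ d₂.B)
    {J : Type w} [Category.{w'} J] {c c' : J ⥤ D₁ᵒᵖ} (α : c ⟶ c') [HasColimit (c ⋙ d₁.B)]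
    [HasColimit ((c ⋙ E.functor.op) ⋙ d₂.B)] [HasColimit (c' ⋙ d₁.B)]
    [HasColimit ((c' ⋙ E.functor.op) ⋙ d₂.B)] :
    (HasColimit.isoOfNatIso ((Functor.isoWhiskerLeft c ΨB).trans
          (Functor.associator c E.functor.op d₂.B).symm)).hom ≫
        colimMap (Functor.whiskerRight (Functor.whiskerRight α E.functor.op) d₂.B) =
      colimMap (Functor.whiskerRight α d₁.B) ≫
        (HasColimit.isoOfNatIso ((Functor.isoWhiskerLeft c' ΨB).trans
          (Functor.associator c' E.functor.op d₂.B).symm)).hom := by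
  refine colimit.hom_ext fun j => ?_
  simp only [HasColimit.isoOfNatIso_ι_hom_assoc, Iso.trans_hom, Iso.symm_hom, NatTrans.comp_app,
    Functor.isoWhiskerLeft_hom, Functor.whiskerLeft_app, Functor.associator_inv_app,
    ι_colimMap, Functor.whiskerRight_app, ι_colimMap_assoc, HasColimit.isoOfNatIso_ι_hom,
    Category.assoc]
  exact (ΨB.hom.naturality_assoc (α.app j) _).symm

/-- **(δ) Thm. 2.4 (ii), first step, "a pair of COMPATIBLE isomorphisms `G₁ ⥲ G₂`; `K̄₁^× ⥲ K̄₂^×`"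
(FrdII p. 21 ll. 2–4), formal half.**  For FIELDWISE SATURATED `Φ₁`, `Φ₂`, the base equivalence
`E = Ψ^Base` and the L02 slot `ΨB : B₁ ≅ E^op ⋙ B₂` (hypotheses), and any system `c : J ⥤ D₁ᵒᵖ` along which the
four direct limits exist, there is an isomorphism `lim→_j K_{1,A_j}^× ≅ lim→_j K_{2,Ψ A_j}^×` which, for EVERY
natural endomorphism `σ` of `c` (every compatible family `(σ_j ∈ End_D(A_j))_j`, in particular every element
of `Aut c = lim_j Aut_D(A_j)`), intertwines the action of `σ` on the first direct limit with the action of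
`Ψ^Base(σ) = σ ▷ E^op` on the second.  The identification of `Aut c` with the fundamental group `G₁` of the
base and the "up to elements of `G₂`" clause are base-structure content not typed here (module docstring).
[cite: MochizukiFrdII2008, Thm 2.4 (ii) p.21] -/
theorem exists_fieldUnits_colimit_iso_equivariant (hfs₁ : d₁.IsFieldwiseSaturated)
    (hfs₂ : d₂.IsFieldwiseSaturated) (E : D₁ ≌ D₂) (ΨB : d₁.B ≅ E.functor.op ⋙ d₂.B)
    {J : Type w} [Category.{w'} J] (c : J ⥤ D₁ᵒᵖ)
    [HasColimit (c ⋙ d₁.B)] [HasColimit (c ⋙ bZeroOn d₁.base)]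
    [HasColimit ((c ⋙ E.functor.op) ⋙ d₂.B)] [HasColimit ((c ⋙ E.functor.op) ⋙ bZeroOn d₂.base)] :
    ∃ e : colimit (c ⋙ bZeroOn d₁.base) ≅ colimit ((c ⋙ E.functor.op) ⋙ bZeroOn d₂.base),
      ∀ σ : c ⟶ c,
        e.hom ≫ colimMap (Functor.whiskerRight (Functor.whiskerRight σ E.functor.op) (bZeroOn d₂.base)) =
          colimMap (Functor.whiskerRight σ (bZeroOn d₁.base)) ≫ e.hom := by
  haveI := d₁.isIso_toB0_of_isFieldwiseSaturated hfs₁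
  haveI := d₂.isIso_toB0_of_isFieldwiseSaturated hfs₂
  refine ⟨(HasColimit.isoOfNatIso (Functor.isoWhiskerLeft c (asIso d₁.toB0))).symm ≪≫
      HasColimit.isoOfNatIso ((Functor.isoWhiskerLeft c ΨB).trans
        (Functor.associator c E.functor.op d₂.B).symm) ≪≫
      HasColimit.isoOfNatIso (Functor.isoWhiskerLeft (c ⋙ E.functor.op) (asIso d₂.toB0)), fun σ => ?_⟩
  have h₁ := d₁.colimit_toB0_iso_equivariant hfs₁ σ
  have h₂ := d₂.colimit_toB0_iso_equivariant hfs₂ (Functor.whiskerRight σ E.functor.op)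
  have h₃ := colimit_transport_iso_equivariant d₁ d₂ E ΨB σ
  have h₁' : (HasColimit.isoOfNatIso (Functor.isoWhiskerLeft c (asIso d₁.toB0))).inv ≫
      colimMap (Functor.whiskerRight σ d₁.B) = colimMap (Functor.whiskerRight σ (bZeroOn d₁.base)) ≫
        (HasColimit.isoOfNatIso (Functor.isoWhiskerLeft c (asIso d₁.toB0))).inv := by
    rw [Iso.inv_comp_eq, ← Category.assoc, h₁, Category.assoc, Iso.hom_inv_id, Category.comp_id]
  simp only [Iso.trans_hom, Iso.symm_hom, Category.assoc]
  rw [h₂, reassoc_of% h₃, reassoc_of% h₁']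

end PadicFrd

end Literature.AlgebraicGeometry.Frobenioids
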